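import Literature.Algebra.Polynomial.CasasAlvero.Degree4
import HarnessLib

/-!
# Pure powers are Casas-Alvero (the converse direction, for the record)

`isCasasAlvero_X_sub_C_pow`: over any commutative ring, `(X - a)^d` shares the root `a` with each of its Hasse derivatives
`D^{(i)} (X - a)^d = C(d, i) · (X - a)^(d - i)`, `0 < i < d`.  Hence `HoldsInDegree R d` says exactly that the pure `d`-th powers are
the ONLY monic Casas-Alvero polynomials of degree `d` over `R` — the definition used in `PrimePower.lean`, `Induction.lean`, `Descent.lean`,
`Degree4.lean` is not vacuous and the theorems there are characterisations. [folklore]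
-/

noncomputable section

open Polynomial

namespace Literature.Algebra.Polynomial.CasasAlvero

variable {R : Type*} [CommRing R]

/-- `D^{(i)} (X - a)^d = C(d,i) · (X - a)^(d-i)`. [folklore] -/
theorem hasseDeriv_X_sub_C_pow (a : R) (d i : ℕ) :
    hasseDeriv i ((X - C a) ^ d) = C (d.choose i : R) * (X - C a) ^ (d - i) := by
  have h1 : ∀ n : ℕ, (X - C a) ^ n = taylor (-a) (X ^ n : R[X]) := fun n => by
    rw [taylor_X_pow, map_neg, sub_eq_add_neg]
  rw [h1, hasseDeriv_taylor, X_pow_eq_monomial, hasseDeriv_monomial, mul_one, ← C_mul_X_pow_eq_monomial,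
    taylor_mul, taylor_C, ← h1]

/-- Pure powers `(X - a)^d` are Casas-Alvero. [folklore] -/
theorem isCasasAlvero_X_sub_C_pow (a : R) (d : ℕ) : IsCasasAlvero ((X - C a) ^ d) := by
  intro i hi0 hi
  have hid : i < d := by
    have := natDegree_pow_le_of_le d (natDegree_X_sub_C_le a)
    omega
  refine ⟨a, by simp [zero_pow (by omega : d ≠ 0)], ?_⟩
  rw [hasseDeriv_X_sub_C_pow]
  simp [zero_pow (by omega : d - i ≠ 0)]

end Literature.Algebra.Polynomial.CasasAlvero
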